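import Mathlib
import Literature.RepresentationTheory.FiniteGroups.IrreducibleCharacters
import Literature.RepresentationTheory.FiniteGroups.InducedClassFunction
import Literature.RepresentationTheory.FiniteGroups.MonomialRepresentation
import Summits.MatrixMultiplication.MatrixMultiplication.Theorems.LieRankDesigns.Negative.Basics
import Summits.MatrixMultiplication.MatrixMultiplication.Theorems.LevelGradedCohnUmansLieRankDesignsStubLevelOfFixedVector
import Summits.MatrixMultiplication.MatrixMultiplication.Theorems.SubgroupIdentityDesigns.Negative.BorelLevelOne
import Summits.MatrixMultiplication.MatrixMultiplication.Theorems.SubgroupIdentityDesigns.Negative.GrassmannCharacter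
import Summits.MatrixMultiplication.MatrixMultiplication.Theorems.SubgroupIdentityDesigns.Negative.GrassmannOrbits
import Summits.MatrixMultiplication.MatrixMultiplication.Theorems.SubgroupIdentityDesigns.Negative.FlagCharacter

/-!
# The twisted flag characters `Ψ_χ = Ind_{P'}^{GL_{k+l}} (χ₁ ⊗ ⋯ ⊗ χ_k ⊗ 1)` have level `≤ k`

Supports stmt-MatrixMultiplication-14079 (crux `SubgroupIdentityDesigns`, route
    `LevelGradedCohnUmans`;
BLOCK-SLICES §2).  VALUE = theorem, NOT summit progress.

`P' = flagStab F k l` is the parabolic of type `(1^k; l)` (`FlagCharacter`).  For a `k`-tuple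
`χ = (χ_i)` of multiplicative characters of `F` let `λ_χ(h) = ∏_i χ_i(h_{c_i c_i})`
(`c_i = castAdd l i`; `lam`, a hom `P' →* ℂˣ` since the first `k` diagonal entries are
multiplicative on `P'`, `diag_mul`) and `Ψ_χ = Ind_{P'}^G λ_χ` (`twChar`, a character:
`isCharacter_twChar`).  Main results:
* `twChar_apply` (Mackey/Frobenius formula), `twChar_one` (`Ψ_χ(1) = [G : P']`);
* `twChar_apply_eq_sum` — `Ψ_χ(y) = ∑_q ∑_{A upper} (∏_i χ_i(A_{ii})) [y X_q = X_q A]`, a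
  combination of frame indicators, hence **`twChar_mem_levelSet`: `Ψ_χ ∈ F_k`** over `𝔽_p`;
* torus elements `diagGL`, their conjugates by permutation matrices (`conj_diagGL`) and
  `lam_diagGL`, used in the sequel `FlagTwistNorm` to show `⟨Ψ_χ, Ψ_χ⟩ = 1` for distinct
  non-trivial `χ_i`, which closes the block-slice line for ALL `l ≥ 3` when `p ≥ k + 2`.
-/

set_option linter.dupNamespace false

noncomputable section

open scoped BigOperators Matrix Classical
open Literature.RepresentationTheory.FiniteGroups
open Summit.MatrixMultiplication.MatrixMultiplication.Theorems.LieRankDesigns.Negative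
  (GLm Mat levelSet)
open Summit.MatrixMultiplication.MatrixMultiplication.Theorems.LieRankDesigns.LevelOfFixedVector
  (sum_mem_levelSet smul_mem_levelSet)

namespace Summit.MatrixMultiplication.MatrixMultiplication.Theorems.SubgroupIdentityDesigns.Negative
namespace FlagTwist

open GrassmannCharacter (stdFrame mul_stdFrame_apply stdFrame_mul_castAdd conj_frame_iff
  frame_coeff_unique)
open GrassmannOrbits (permGL permGL_apply permGL_inv permGL_mul_apply)
open FlagCharacter (blk flagStab mem_flagStab_iff mem_flagStab_iff_frame)

section General

variable {F : Type} [Field F] [Fintype F] [DecidableEq F] {k l : ℕ}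

/-! ## The first `k` diagonal entries are multiplicative on `P'` -/

omit [Fintype F] in
/-- `(g h)_{c c} = g_{c c} h_{c c}` for `g, h ∈ P'` and `c = castAdd l i`. -/
theorem diag_mul {g h : GL (Fin (k + l)) F} (hg : g ∈ flagStab F k l) (hh : h ∈ flagStab F k l)
    (i : Fin k) :
    ((g : Matrix (Fin (k + l)) (Fin (k + l)) F) * (h : Matrix (Fin (k + l)) (Fin (k + l)) F))
        (Fin.castAdd l i) (Fin.castAdd l i) =
      (g : Matrix (Fin (k + l)) (Fin (k + l)) F) (Fin.castAdd l i) (Fin.castAdd l i) *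
        (h : Matrix (Fin (k + l)) (Fin (k + l)) F) (Fin.castAdd l i) (Fin.castAdd l i) := by
  rw [Matrix.mul_apply]
  refine Finset.sum_eq_single (Fin.castAdd l i) (fun m _ hm => ?_)
    (fun h => absurd (Finset.mem_univ _) h)
  rw [mem_flagStab_iff] at hg hh
  by_cases h1 : blk k l m < blk k l (Fin.castAdd l i)
  · rw [hg _ _ h1, zero_mul]
  · by_cases h2 : blk k l (Fin.castAdd l i) < blk k l m
    · rw [hh _ _ h2, mul_zero]
    · exfalso
      apply hm
      apply Fin.ext
      have := i.isLt
      simp only [blk, Fin.val_castAdd] at h1 h2 ⊢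
      omega

omit [Fintype F] in
/-- The first `k` diagonal entries of an element of `P'` are non-zero. -/
theorem diag_ne_zero (h : flagStab F k l) (i : Fin k) :
    ((h : GL (Fin (k + l)) F) : Matrix (Fin (k + l)) (Fin (k + l)) F) (Fin.castAdd l i)
        (Fin.castAdd l i) ≠ 0 := by
  intro h0
  have h1 := diag_mul h.2 h⁻¹.2 i
  rw [← Units.val_mul, ← Subgroup.coe_mul, mul_inv_cancel, Subgroup.coe_one, Units.val_one,
    Matrix.one_apply_eq, h0, zero_mul] at h1
  exact one_ne_zero h1

/-- The `i`-th diagonal entry as a hom `P' →* Fˣ`. -/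
def dg (i : Fin k) : flagStab F k l →* Fˣ where
  toFun h := Units.mk0 _ (diag_ne_zero h i)
  map_one' := Units.ext (by simp)
  map_mul' a b := Units.ext (by
    simp only [Units.val_mk0, Units.val_mul, Subgroup.coe_mul]
    exact diag_mul a.2 b.2 i)

omit [Fintype F] in
/-- Value of `dg`. -/
theorem coe_dg (i : Fin k) (h : flagStab F k l) :
    ((dg i h : Fˣ) : F) = ((h : GL (Fin (k + l)) F) : Matrix (Fin (k + l)) (Fin (k + l)) F)
      (Fin.castAdd l i) (Fin.castAdd l i) := rfl

/-- **`λ_χ = ∏_i χ_i ∘ dg_i : P' →* ℂˣ`.** -/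
def lam (χ : Fin k → MulChar F ℂ) : flagStab F k l →* ℂˣ := ∏ i : Fin k, (χ i).toUnitHom.comp (dg i)

omit [Fintype F] in
/-- Value of `λ_χ`. -/
theorem coe_lam (χ : Fin k → MulChar F ℂ) (h : flagStab F k l) :
    ((lam χ h : ℂˣ) : ℂ) = ∏ i : Fin k, χ i (((h : GL (Fin (k + l)) F) :
      Matrix (Fin (k + l)) (Fin (k + l)) F) (Fin.castAdd l i) (Fin.castAdd l i)) := by
  rw [lam, MonoidHom.finsetProd_apply, Units.coe_prod]
  exact Finset.prod_congr rfl fun i _ => MulChar.coe_toUnitHom (χ i) (dg i h)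

omit [Fintype F] in
/-- Value of `λ_χ` on `⟨x, hx⟩`. -/
theorem coe_lam_mk (χ : Fin k → MulChar F ℂ) {x : GL (Fin (k + l)) F} (hx : x ∈ flagStab F k l) :
    ((lam χ ⟨x, hx⟩ : ℂˣ) : ℂ) = ∏ i : Fin k, χ i ((x : Matrix (Fin (k + l)) (Fin (k + l)) F)
      (Fin.castAdd l i) (Fin.castAdd l i)) :=
  coe_lam χ ⟨x, hx⟩

omit [Fintype F] in
/-- `λ_χ` is conjugation invariant inside `P'`. -/
theorem lam_conj (χ : Fin k → MulChar F ℂ) {g h : GL (Fin (k + l)) F} (hg : g ∈ flagStab F k l)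
    (hh : h ∈ flagStab F k l) (hmem : g⁻¹ * h * g ∈ flagStab F k l) :
    lam χ ⟨g⁻¹ * h * g, hmem⟩ = lam χ ⟨h, hh⟩ := by
  have e : (⟨g⁻¹ * h * g, hmem⟩ : flagStab F k l) = ⟨g, hg⟩⁻¹ * ⟨h, hh⟩ * ⟨g, hg⟩ := rfl
  rw [e, map_mul, map_mul, map_inv, mul_comm _ (lam χ ⟨g, hg⟩), ← mul_assoc, mul_inv_cancel,
    one_mul]

/-! ## `Ψ_χ = Ind_{P'}^G λ_χ` -/

/-- **`Ψ_χ = Ind_{P'}^G λ_χ`.** -/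
def twChar (χ : Fin k → MulChar F ℂ) : GL (Fin (k + l)) F → ℂ :=
  indClassFun (flagStab F k l) (fun h => ((lam χ h : ℂˣ) : ℂ))

/-- `Ψ_χ` is a character. -/
theorem isCharacter_twChar (χ : Fin k → MulChar F ℂ) :
    IsCharacter (GL (Fin (k + l)) F) (twChar χ) :=
  isCharacter_indClassFun_monoidHom (flagStab F k l) (lam χ)

/-- `Ψ_χ` is a class function. -/
theorem isClassFun_twChar (χ : Fin k → MulChar F ℂ) :
    IsClassFun (G := GL (Fin (k + l)) F) (twChar χ) :=
  isClassFun_indClassFun _ _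

/-- Frobenius' formula: `Ψ_χ(y) = ∑_{q : y q = q} λ_χ(g_q⁻¹ y g_q)`. -/
theorem twChar_apply (χ : Fin k → MulChar F ℂ) (y : GL (Fin (k + l)) F) :
    twChar χ y = ∑ q : GL (Fin (k + l)) F ⧸ flagStab F k l,
      (if h : q.out⁻¹ * y * q.out ∈ flagStab F k l then ((lam χ ⟨_, h⟩ : ℂˣ) : ℂ) else 0) := by
  unfold twChar
  rw [indClassFun_eq_sum_quotient _ (isClassFun_coe_monoidHom (flagStab F k l) (lam χ))]
  refine Finset.sum_congr rfl fun q _ => ?_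
  by_cases hmem : q.out⁻¹ * y * q.out ∈ flagStab F k l
  · rw [dif_pos hmem]
    exact extend_subtypeVal_apply _ _ ⟨_, hmem⟩
  · rw [dif_neg hmem]
    exact extend_subtypeVal_of_not_mem _ _ hmem

/-- **`Ψ_χ(1) = [G : P']`.** -/
theorem twChar_one (χ : Fin k → MulChar F ℂ) :
    twChar (l := l) χ 1 = (Fintype.card (GL (Fin (k + l)) F ⧸ flagStab F k l) : ℂ) := by
  rw [twChar_apply]
  have h : ∀ q : GL (Fin (k + l)) F ⧸ flagStab F k l,
      (if h : q.out⁻¹ * 1 * q.out ∈ flagStab F k l then ((lam χ ⟨_, h⟩ : ℂˣ) : ℂ) else 0) = 1 := by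
    intro q
    have hmem : q.out⁻¹ * 1 * q.out ∈ flagStab F k l := by
      rw [mul_one, inv_mul_cancel]
      exact one_mem _
    rw [dif_pos hmem, coe_lam_mk, mul_one, inv_mul_cancel, Units.val_one]
    exact Finset.prod_eq_one fun i _ => by rw [Matrix.one_apply_eq, map_one]
  rw [Finset.sum_congr rfl fun q _ => h q, Finset.sum_const, Finset.card_univ, nsmul_eq_mul,
    mul_one]

/-! ## Frame expansion: `Ψ_χ ∈ F_k` -/

/-- The coset term of `Ψ_χ(y)` at `q` is `∑_{A upper} (∏ χ_i(A_{ii})) [y X_q = X_q A]`. -/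
theorem coset_term_eq_sum (χ : Fin k → MulChar F ℂ) (y : GL (Fin (k + l)) F)
    (q : GL (Fin (k + l)) F ⧸ flagStab F k l) :
    (if h : q.out⁻¹ * y * q.out ∈ flagStab F k l then ((lam χ ⟨_, h⟩ : ℂˣ) : ℂ) else 0) =
      ∑ A ∈ (Finset.univ.filter fun A : Matrix (Fin k) (Fin k) F => ∀ i j : Fin k, j < i → A i j =
          0),
        (∏ i : Fin k, χ i (A i i)) *
          (if (y : Matrix (Fin (k + l)) (Fin (k + l)) F) *
              (((q.out : GL (Fin (k + l)) F) : Matrix (Fin (k + l)) (Fin (k + l)) F) *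
                stdFrame F k l) =
              ((q.out : GL (Fin (k + l)) F) : Matrix (Fin (k + l)) (Fin (k + l)) F) *
                stdFrame F k l * A
            then (1 : ℂ) else 0) := by
  by_cases hmem : q.out⁻¹ * y * q.out ∈ flagStab F k l
  · obtain ⟨A₀, hA₀, hE⟩ := (mem_flagStab_iff_frame _).mp hmem
    have hy := (conj_frame_iff q.out y A₀).mp hE
    rw [dif_pos hmem, Finset.sum_eq_single A₀]
    · rw [if_pos hy, mul_one, coe_lam_mk]
      refine Finset.prod_congr rfl fun i _ => ?_
      rw [← mul_stdFrame_apply ((q.out⁻¹ * y * q.out : GL (Fin (k + l)) F) :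
        Matrix (Fin (k + l)) (Fin (k + l)) F) (Fin.castAdd l i) i, hE, stdFrame_mul_castAdd]
    · intro A _ hA
      rw [if_neg (fun h => hA (frame_coeff_unique q.out (h.symm.trans hy))), mul_zero]
    · intro h
      exact absurd (Finset.mem_filter.mpr ⟨Finset.mem_univ _, hA₀⟩) h
  · rw [dif_neg hmem]
    symm
    refine Finset.sum_eq_zero fun A hA => ?_
    rw [if_neg, mul_zero]
    intro h
    exact hmem ((mem_flagStab_iff_frame _).mpr
      ⟨A, (Finset.mem_filter.mp hA).2, (conj_frame_iff q.out y A).mpr h⟩)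

/-- **Frame expansion of `Ψ_χ`.** -/
theorem twChar_apply_eq_sum (χ : Fin k → MulChar F ℂ) (y : GL (Fin (k + l)) F) :
    twChar χ y = ∑ q : GL (Fin (k + l)) F ⧸ flagStab F k l,
      ∑ A ∈ (Finset.univ.filter fun A : Matrix (Fin k) (Fin k) F => ∀ i j : Fin k, j < i → A i j =
          0),
        (∏ i : Fin k, χ i (A i i)) *
          (if (y : Matrix (Fin (k + l)) (Fin (k + l)) F) *
              (((q.out : GL (Fin (k + l)) F) : Matrix (Fin (k + l)) (Fin (k + l)) F) *
                stdFrame F k l) =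
              ((q.out : GL (Fin (k + l)) F) : Matrix (Fin (k + l)) (Fin (k + l)) F) *
                stdFrame F k l * A
            then (1 : ℂ) else 0) := by
  rw [twChar_apply]
  exact Finset.sum_congr rfl fun q _ => coset_term_eq_sum χ y q

/-! ## Torus elements -/

omit [Fintype F] in
/-- The diagonal matrix with unit entries `v`. -/
def diagGL (v : Fin (k + l) → Fˣ) : GL (Fin (k + l)) F :=
  ⟨Matrix.diagonal fun a => (v a : F), Matrix.diagonal fun a => ((v a)⁻¹ : Fˣ),
    by rw [Matrix.diagonal_mul_diagonal]; simp, by rw [Matrix.diagonal_mul_diagonal]; simp⟩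

omit [Fintype F] [DecidableEq F] in
/-- Entries of `diagGL v`. -/
theorem diagGL_apply (v : Fin (k + l) → Fˣ) (a b : Fin (k + l)) :
    ((diagGL v : GL (Fin (k + l)) F) : Matrix (Fin (k + l)) (Fin (k + l)) F) a b =
      if a = b then (v a : F) else 0 :=
  Matrix.diagonal_apply _ a b

omit [Fintype F] in
/-- `diagGL v ∈ P'`. -/
theorem diagGL_mem (v : Fin (k + l) → Fˣ) : diagGL v ∈ flagStab F k l := by
  rw [mem_flagStab_iff]
  intro a b hab
  rw [diagGL_apply, if_neg]
  rintro rfl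
  exact lt_irrefl _ hab

omit [Fintype F] in
/-- `λ_χ(diag v) = ∏_i χ_i(v_{c_i})`. -/
theorem lam_diagGL (χ : Fin k → MulChar F ℂ) (v : Fin (k + l) → Fˣ) :
    ((lam χ ⟨diagGL v, diagGL_mem v⟩ : ℂˣ) : ℂ) = ∏ i : Fin k, χ i (v (Fin.castAdd l i) : F) := by
  rw [coe_lam_mk]
  exact Finset.prod_congr rfl fun i _ => by rw [diagGL_apply, if_pos rfl]

omit [Fintype F] [DecidableEq F] in
/-- Conjugating a torus element by a permutation matrix permutes its entries:
`w(τ)⁻¹ diag(v) w(τ) = diag(v ∘ τ)`. -/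
theorem conj_diagGL (τ : Equiv.Perm (Fin (k + l))) (v : Fin (k + l) → Fˣ) :
    (permGL τ : GL (Fin (k + l)) F)⁻¹ * diagGL v * permGL τ = diagGL (fun a => v (τ a)) := by
  rw [permGL_inv]
  refine Units.ext (Matrix.ext fun a b => ?_)
  rw [Units.val_mul, Units.val_mul, Matrix.mul_assoc, permGL_mul_apply, inv_inv, Matrix.mul_apply,
    diagGL_apply]
  simp only [permGL_apply, mul_ite, mul_one, mul_zero, Finset.sum_ite_eq', Finset.mem_univ,
    if_true, diagGL_apply, EmbeddingLike.apply_eq_iff_eq]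

omit [Fintype F] in
/-- `λ_χ(diag(δ_d^x)) = ∏_i χ_i((δ_d^x)_{c_i})` with `δ_d^x = mulSingle d x`: it is `χ_{i₁}(x)` if
`d = c_{i₁}` and `1` if `d` is not one of the `c_i`. -/
theorem lam_diagGL_mulSingle_castAdd (χ : Fin k → MulChar F ℂ) (i₁ : Fin k) (x : Fˣ) :
    ((lam χ ⟨diagGL (Pi.mulSingle (Fin.castAdd l i₁) x),
        diagGL_mem (Pi.mulSingle (Fin.castAdd l i₁) x)⟩ : ℂˣ) : ℂ) = χ i₁ (x : F) := by
  rw [lam_diagGL, Finset.prod_eq_single i₁]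
  · rw [Pi.mulSingle_eq_same]
  · intro i _ hi
    rw [Pi.mulSingle_eq_of_ne (fun h => hi (Fin.castAdd_inj.mp h)), Units.val_one, map_one]
  · intro h
    exact absurd (Finset.mem_univ _) h

omit [Fintype F] in
/-- If `d` is none of the `c_i` then `λ_χ(diag(δ_d^x)) = 1`. -/
theorem lam_diagGL_mulSingle_of_ne (χ : Fin k → MulChar F ℂ) {d : Fin (k + l)}
    (hd : ∀ i : Fin k, Fin.castAdd l i ≠ d) (x : Fˣ) :
    ((lam χ ⟨diagGL (Pi.mulSingle d x), diagGL_mem (Pi.mulSingle d x)⟩ : ℂˣ) : ℂ) = 1 := by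
  rw [lam_diagGL]
  exact Finset.prod_eq_one fun i _ => by
    rw [Pi.mulSingle_eq_of_ne (hd i), Units.val_one, map_one]

end General

/-! ## Level `≤ k` over `𝔽_p` -/

variable {p : ℕ} [hp : Fact p.Prime] {k l : ℕ}

/-- **`Ψ_χ ∈ F_k`**: a combination of frame indicators `[g X = X A]`. -/
theorem twChar_mem_levelSet (χ : Fin k → MulChar (ZMod p) ℂ) :
    twChar (l := l) χ ∈ levelSet p (k + l) k := by
  have h : twChar (l := l) χ = fun y => ∑ q : GLm p (k + l) ⧸ flagStab (ZMod p) k l,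
      ∑ A ∈ (Finset.univ.filter fun A : Matrix (Fin k) (Fin k) (ZMod p) =>
          ∀ i j : Fin k, j < i → A i j = 0),
        (fun g : GLm p (k + l) => (∏ i : Fin k, χ i (A i i)) * (if (g : Mat p (k + l)) *
            (((q.out : GLm p (k + l)) : Mat p (k + l)) * stdFrame (ZMod p) k l) =
            ((q.out : GLm p (k + l)) : Mat p (k + l)) * stdFrame (ZMod p) k l * A
          then (1 : ℂ) else 0)) y := funext fun y => twChar_apply_eq_sum χ y
  rw [h]
  exact sum_mem_levelSet _ _ fun q _ => sum_mem_levelSet _ _ fun A _ =>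
    smul_mem_levelSet (frameIndicator_mem_levelSet _ _) _

end FlagTwist
end Summit.MatrixMultiplication.MatrixMultiplication.Theorems.SubgroupIdentityDesigns.Negative
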